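import Summits.QuantumFields.BalabanUV.Beta.GAN24.S3DiffLAligned
import Summits.QuantumFields.BalabanUV.Beta.GAN24.TaylorDiffLamSymAt
import Summits.QuantumFields.BalabanUV.Beta.GAN24.TaylorRowLamSymAt

/-!
# Road «S3-Taylor», Λ DIFF row R3-dL AT THE SYM TABLE, part 2 of 3: the difference of the two ALIGNED sym Λ pieces with their common prefactor
# (**`abs_pref_sandwich_sub_le`**) and member `p+1`'s sym piece aligned onto member `p`'s lattice (**`piece_succ_eq_pref_mul_sandwich`**)
# (sym twin of leaf-06 g41's (ρ) `S3DiffLAlignedAt`; `S3DiffLAligned.{key_count, pref_succ_mul}`, `S3DiffLVertex`, `SandwichDecimate` root-free BY NAME)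

NOT IN PRINT — OUR BOOKKEEPING (road-P2 = `b2b-balaban-gan24-p2` gen 56, 2026-08-25; row G-an2-4 ∕ (CONV-C), the (α-0) chain at row D1's literal
OF RECORD (III′) `JsB12CombShSym`; [folklore] composition BY NAME; 0 cite, 0 `def … : Prop`, 0 `sorry`).  Weight 0.  NEVER «G-an2-4 closed» as (CONV-C);
NOT D1, NOT BetaPertH, NOT continuum, NOT Clay; NO campaign opened (an2 W-4) — typed while idle under R-2 as a brick of the located «SYM-S3-Λ-DIFF» transfer
(the UNDRESSED top-aligned PAIR letter of the (III′) Λ-born RATE half `hBd-Λ`, road-P2 MEMO M-gan24p2-g56-1, `gen56/S-CAMPAIGN-SIZING-g56.v0_7.md` §2(c)).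

METHOD = the OWNER gan24-p1's gen-6 `mkroot.py` rule (road-P2's `tools/mksym.py`): leaf-06 g41's «ROOTED-S3-Λ-DIFF» file VERBATIM with an1's SYM table
`symHessFFAt (toSite r) Lc` (`r ∈ box (d+1) Lc`; `SymAveragingHessianCounts`: SAME support `symHessKerAt_eq_zero_left ∕ _right`, SAME entry bound
`abs_symHessKerAt_le ≤ 2ℓ²`, SAME bi-localisation `biLoc_symHessFFAt` as the rooted table) in place of `hessFFAt (toSite r) Lc`, and the symmetrised increment
`E3UnitSplitLevelsSymAt.symLagrIncAt` (M.66) in place of `SpineRooted.lagrIncAt`; every ROOT-FREE lemma of the base modules is used BY NAME (not re-declared);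
same theorem names in this file's namespace; base and rooted modules untouched; no zero-root sanity `example` (the sym table has no root-0 base twin).
Discharges NOTHING of (hS, hSall), the K-slot, hBdev or BetaPertH by itself.

## Contents (`d` generic; root `r ∈ box (d+1) Lc`)
§3-σ **`abs_pref_sandwich_sub_le`** (inputs: part 1 `TaylorDiffLamSymAt.lamSandwich_sub_le`, (ρ-c)-sym `TaylorRowLamTableSymAt.{table_mass_le, mem_boxW_of_ne_zero,
mem_imageY_of_ne_zero}`); §4-σ **`piece_succ_eq_pref_mul_sandwich`** ((ρ-c)-sym `TaylorRowLamSymAt.piece_eq_pref_mul_sandwich` (M.69) at `(ℓ+1, k, p+1)` +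
leaf-04-g20's «SANDWICH-DECIMATE*» with the generic table `K := symHessFFAt (toSite r) Lc μ`).  SAME displayed constants as at the rooted table.
-/

noncomputable section

open Finset
open scoped BigOperators
open Literature.MathematicalPhysics.QuantumFieldTheory
open Literature.MathematicalPhysics.QuantumFieldTheory.Balaban1983to89
open Literature.MathematicalPhysics.QuantumFieldTheory.Balaban1983to89.Beta
open Literature.Probability.LatticeModels (Torus.proj Torus.proj_apply)
open AffineAveraging (Site Form1 unitVec unitVec_apply box toSite)
open AffineReproduction (contourSumAdj)
open LatticeForm (quo)
open B12Sec2to5 (l1 l1_nonneg)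
open ExpKernelCalculus (MKer Zl BiLoc Decays l1_sub_triangle l1_sub_symm l1_natSmul)
open OneStepResolventKernel (Fib KInv LocStencil proj_zsmul quo_zsmul eq_zsmul_quo_of_proj KInv_inr_inr_coarse)
open OneStepKernelFamily (KInvStep legSet legW legPt)
open KernelSpecInstance (wH wΦ)
open KKTFluctuationKernel (GamΦ)
open InterLevelTransport (SLam avgLift cwsum cwsum_apply onLat onLat_zsmul onLat_off)
open BalabanStepJets (lamCoeffOf)
open AveragingHessianKernels (ell)
open Summit.QuantumFields.BalabanUV.Beta.SymAveragingHessianCounts (symHessFFAt symHessKerAt symHessFFAt_inl_inl symHessFFAt_inl_inr symHessFFAt_inr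
  symHessKerAt_eq_zero_left symHessKerAt_eq_zero_right abs_symHessKerAt_le biLoc_symHessFFAt)
open Summit.QuantumFields.BalabanUV.Beta.GAN24.E3UnitSplitLevelsSymAt (symLagrIncAt)
open Summit.QuantumFields.BalabanUV.Beta.HessKerDressedUnits (unitK unitK_apply legScale_inr)
open Summit.QuantumFields.BalabanUV.Beta.SecondOrderUnits (KInvStep_mm_eq_KInv_mm)
open Summit.QuantumFields.BalabanUV.Beta.GAN24.CombesThomas (SupBound UnitDecayK CauchyDecayK sfStep smStep ConvCKWall)
open Summit.QuantumFields.BalabanUV.Beta.GAN24.E3UnitSplit (e3OfS e3OfS_inl_inr e3OfS_inr e3Lam_unit_split)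
open Summit.QuantumFields.BalabanUV.Beta.GAN24.TaylorLamVertexPairing (quo_quo abs_contourSumAdj_le_exp)
open Summit.QuantumFields.BalabanUV.Beta.GAN24.TaylorBlockSum (nonneg_of_dominated)
open Summit.QuantumFields.BalabanUV.Beta.GAN24.StencilSlotE3PhiLeg (phiLeg_three pow_N_eq)
open Summit.QuantumFields.BalabanUV.Beta.GAN24.TaylorDiffLam (sandwich_const_mul_vertex contourSumAdj_sub
  contourSumAdj_const_mul onLat_sub_apply onLat_const_mul_apply abs_onLat_contourSumAdj_le)
open Summit.QuantumFields.BalabanUV.Beta.GAN24.TaylorDiffLamSymAt (lamSandwich_sub_le)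
open Summit.QuantumFields.BalabanUV.Beta.GAN24.TaylorRowLam (power_count inv_pow_succ_succ mul_exp_mono_rate l1_le_of_mem_imageY l1_le_of_mem_box)
open Summit.QuantumFields.BalabanUV.Beta.GAN24.TaylorRowLamSymAt (piece_eq_pref_mul_sandwich table_mass_le mem_boxW_of_ne_zero mem_imageY_of_ne_zero)
open Summit.QuantumFields.BalabanUV.Beta.GAN24.SandwichDecimate (decLeg decLeg_apply sandwich_decimate_avgLift_of_legs abs_decLeg_le abs_decLeg_le')
open Summit.QuantumFields.BalabanUV.Beta.GAN24.S3DiffL (key_count pref_succ_mul abs_vertex_le abs_vertex_succ_le abs_vertex_succ_raw_le abs_vertex_sub_le)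

namespace Summit.QuantumFields.BalabanUV.Beta.GAN24.S3DiffLSymAt

variable {d : ℕ} {Lc : ℕ} [NeZero Lc] {r : Fin (d + 1) → ℕ}

/-! ## §3-ρ The difference of the two ALIGNED rooted Λ sandwiches with their common prefactor -/

section Main

variable {κ CA CA' CB CB' dA dB CΦ dΦ : ℝ} {x' u' z' : Site (d + 1)} {A A' B B' : Fin (d + 1) → Site (d + 1) → ℝ}

/-- [folklore] **THE DIFFERENCE OF THE TWO ALIGNED ROOTED Λ PIECES** (in-block root `r ∈ box (d+1) Lc`; member `p = ℓ+k+1` at `N = Lc^p` and member `p+1` read on member `p`'s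
lattice, common prefactor `pref = −(cΛ∕Lc^{d+1})·N^{d−2}·M^{d+3}`): the outer legs `A, B` (member `p`), `A′, B′` (member `p+1`, decimated) are
ABSTRACT functions in `sandwich_bound`'s block-`ℓ¹` currency together with their differences (`dA`, `dB` — the located input «(N1-Cauchy)»),
the vertex legs are the explicit contour read-outs of the unit-normalised multiplier legs of the two members (`CΦ`, one-step difference `dΦ`
— the K-slot's `CauchyDecayK`).  Then `|pref·SW(A′,H′,B′) − pref·SW(A,H,B)| ≤ (|cΛ|∕Lc^{d+1})·(d+1)·(dA·CB′·CΦ + CA·CB′·dΦ + CA·dB·CΦ)·e^κ·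
(8(d+1)(Lc+1)+1)^{d+1}·M₀·K_W·K_U·Zl_{d+1}(κ∕2)·(Lc^{k+2})⁻¹·e^{−(κ∕2)(|x′−u′|₁+|z′−u′|₁)}` — every constant `(ℓ,k)`-FREE. -/
theorem abs_pref_sandwich_sub_le (hr : r ∈ box (d + 1) Lc) (cΛ : ℝ) (ℓ k p : ℕ) (hp : p = ℓ + k + 1) (hκ : 0 < κ) (hCΦ : 0 ≤ CΦ) (hdΦ0 : 0 ≤ dΦ)
    (hA : ∀ l w, |A l w| ≤ CA * Real.exp (-κ * l1 (x' - quo (Lc ^ p) w)))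
    (hB : ∀ l' y, |B l' y| ≤ CB * Real.exp (-κ * l1 (quo (Lc ^ p) y - z')))
    (hA' : ∀ l w, |A' l w| ≤ CA' * Real.exp (-κ * l1 (x' - quo (Lc ^ p) w)))
    (hB' : ∀ l' y, |B' l' y| ≤ CB' * Real.exp (-κ * l1 (quo (Lc ^ p) y - z')))
    (hdA : ∀ l w, |A' l w - A l w| ≤ dA * Real.exp (-κ * l1 (x' - quo (Lc ^ p) w)))
    (hdB : ∀ l' y, |B' l' y - B l' y| ≤ dB * Real.exp (-κ * l1 (quo (Lc ^ p) y - z')))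
    (hΦ : ∀ (κ₁ l : Fin (d + 1)) (y : Site (d + 1)),
      |((Lc : ℝ) ^ p) ^ (2 * (d + 1)) * wΦ (N := Lc ^ p) κ₁ l y| ≤ CΦ * Real.exp (-κ * l1 y))
    (hΦ' : ∀ (κ₁ l : Fin (d + 1)) (y : Site (d + 1)),
      |((Lc : ℝ) ^ (p + 1)) ^ (2 * (d + 1)) * wΦ (N := Lc ^ (p + 1)) κ₁ l y| ≤ CΦ * Real.exp (-κ * l1 y))
    (hdΦ : ∀ (κ₁ l : Fin (d + 1)) (y : Site (d + 1)),
      |((Lc : ℝ) ^ (p + 1)) ^ (2 * (d + 1)) * wΦ (N := Lc ^ (p + 1)) κ₁ l y -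
          ((Lc : ℝ) ^ p) ^ (2 * (d + 1)) * wΦ (N := Lc ^ p) κ₁ l y| ≤ dΦ * Real.exp (-κ * l1 y))
    (κ' : Fin (d + 1)) :
    |(-(cΛ / (Lc : ℝ) ^ (d + 1)) * (((Lc ^ p : ℕ) : ℝ)) ^ ((d : ℤ) - 2) * ((Lc : ℝ) ^ ℓ) ^ (d + 3)) *
        (∑' y : Site (d + 1), ∑ l' : Fin (d + 1),
          (∑' w : Site (d + 1), ∑ l : Fin (d + 1), A' l w *
              ∑ μ : Fin (d + 1), ((((Lc ^ p : ℕ) : ℝ)) ^ (d + 1))⁻¹ * ∑' v : Site (d + 1),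
                ((Lc : ℝ) ^ d * onLat (Lc ^ (ℓ + 1)) (fun Y => (((Lc ^ (p + 1) : ℕ) : ℝ)) ^ (d + 2) *
                    contourSumAdj (Lc ^ k) (fun κ₁ q => wΦ (N := Lc ^ (p + 1)) κ₁ κ' (q - u')) μ Y) v) *
                  onLat (Lc ^ (ℓ + 1)) (fun Y => avgLift (Lc ^ ℓ) (symHessFFAt (toSite r) Lc μ Y)) v w y (Sum.inl l) (Sum.inl l')) * B' l' y) -
      (-(cΛ / (Lc : ℝ) ^ (d + 1)) * (((Lc ^ p : ℕ) : ℝ)) ^ ((d : ℤ) - 2) * ((Lc : ℝ) ^ ℓ) ^ (d + 3)) *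
        (∑' y : Site (d + 1), ∑ l' : Fin (d + 1),
          (∑' w : Site (d + 1), ∑ l : Fin (d + 1), A l w *
              ∑ μ : Fin (d + 1), ((((Lc ^ p : ℕ) : ℝ)) ^ (d + 1))⁻¹ * ∑' v : Site (d + 1),
                onLat (Lc ^ (ℓ + 1)) (fun Y => (((Lc ^ p : ℕ) : ℝ)) ^ (d + 2) *
                    contourSumAdj (Lc ^ k) (fun κ₁ q => wΦ (N := Lc ^ p) κ₁ κ' (q - u')) μ Y) v *
                  onLat (Lc ^ (ℓ + 1)) (fun Y => avgLift (Lc ^ ℓ) (symHessFFAt (toSite r) Lc μ Y)) v w y (Sum.inl l) (Sum.inl l')) * B l' y)| ≤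
      |cΛ| / (Lc : ℝ) ^ (d + 1) *
        (((d : ℝ) + 1) * ((dA * CB' * CΦ + CA * CB' * dΦ + CA * dB * CΦ) * Real.exp κ *
            ((((8 * (d + 1) * (Lc + 1) + 1 : ℕ) : ℝ) ^ (d + 1)) * (((d : ℝ) + 1) * (((d : ℝ) + 1) *
              ((((2 * (4 * (d + 1) + 1) + 1) ^ (d + 1) : ℕ) : ℝ) * (2 * (ell (d + 1) Lc : ℝ) ^ 2))))) *
          (Real.exp (κ * (((d : ℝ) + 1) * (4 * ((d : ℝ) + 1) * (Lc + 1)) + (d + 1))) *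
            Real.exp (κ * (((d : ℝ) + 1) * ((4 * ((d : ℝ) + 1) + 1) + 1) + (d + 1))))) *
          Zl (d + 1) (κ / 2)) *
        ((Lc : ℝ) ^ (k + 2))⁻¹ * Real.exp (-(κ / 2) * (l1 (x' - u') + l1 (z' - u'))) := by
  have hL0 : (0 : ℝ) < Lc := by exact_mod_cast Nat.pos_of_ne_zero (NeZero.ne Lc)
  have hcast : (((Lc ^ p : ℕ) : ℝ)) = (Lc : ℝ) ^ p := by push_cast; rfl
  have hNpos : (0 : ℝ) < ((Lc ^ p : ℕ) : ℝ) := by rw [hcast]; positivity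
  have hCA : 0 ≤ CA := nonneg_of_dominated (Real.exp_pos _) (hA 0 0)
  have hCB' : 0 ≤ CB' := nonneg_of_dominated (Real.exp_pos _) (hB' 0 0)
  have hdA0 : 0 ≤ dA := nonneg_of_dominated (Real.exp_pos _) (hdA 0 0)
  have hdB0 : 0 ≤ dB := nonneg_of_dominated (Real.exp_pos _) (hdB 0 0)
  have hZl : 0 ≤ Zl (d + 1) (κ / 2) := by unfold ExpKernelCalculus.Zl; exact tsum_nonneg fun _ => (Real.exp_pos _).le
  -- the three vertex legs in `sandwich_bound`'s currency
  have hH := fun μ v => abs_vertex_le (d := d) (Lc := Lc) ℓ k p hp hκ.le hCΦ hΦ κ' μ u' v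
  have hH' := fun μ v => abs_vertex_succ_le (d := d) (Lc := Lc) ℓ k p hp hκ.le hCΦ hΦ' κ' μ u' v
  have hdH := fun μ v => abs_vertex_sub_le (d := d) (Lc := Lc) ℓ k p hp hκ.le hdΦ0 hdΦ κ' μ u' v
  have hS := lamSandwich_sub_le (d := d) (Lc := Lc) hr ℓ k p hp hκ hA hB hH hA' hB' hH' hdA hdB hdH
  rw [← mul_sub, abs_mul]
  refine (mul_le_mul_of_nonneg_left hS (abs_nonneg _)).trans ?_
  have habs : |-(cΛ / (Lc : ℝ) ^ (d + 1)) * (((Lc ^ p : ℕ) : ℝ)) ^ ((d : ℤ) - 2) * ((Lc : ℝ) ^ ℓ) ^ (d + 3)| =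
      |cΛ| / (Lc : ℝ) ^ (d + 1) * ((((Lc ^ p : ℕ) : ℝ)) ^ ((d : ℤ) - 2) * ((Lc : ℝ) ^ ℓ) ^ (d + 3)) := by
    rw [abs_mul, abs_mul, abs_neg, abs_div, abs_of_pos (pow_pos hL0 _), abs_of_pos (zpow_pos hNpos _),
      abs_of_pos (pow_pos (pow_pos hL0 _) _), mul_assoc]
  rw [habs]
  -- the combination of the three leg constants
  set Q : ℝ := dA * CB' * CΦ + CA * CB' * dΦ + CA * dB * CΦ with hQ
  have hQ0 : 0 ≤ Q := by rw [hQ]; positivity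
  have hcomb : dA * CB' * ((((Lc ^ p : ℕ) : ℝ)) ^ (d + 2) * ((Lc : ℝ) ^ k * ((CΦ * (((Lc : ℝ) ^ p) ^ (2 * (d + 1)))⁻¹) * Real.exp κ))) +
        CA * CB' * ((((Lc ^ p : ℕ) : ℝ)) ^ (d + 2) * ((Lc : ℝ) ^ k * ((dΦ * (((Lc : ℝ) ^ p) ^ (2 * (d + 1)))⁻¹) * Real.exp κ))) +
        CA * dB * ((((Lc ^ p : ℕ) : ℝ)) ^ (d + 2) * ((Lc : ℝ) ^ k * ((CΦ * (((Lc : ℝ) ^ p) ^ (2 * (d + 1)))⁻¹) * Real.exp κ))) =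
      (((Lc ^ p : ℕ) : ℝ)) ^ (d + 2) * ((Lc : ℝ) ^ k * ((Q * (((Lc : ℝ) ^ p) ^ (2 * (d + 1)))⁻¹) * Real.exp κ)) := by
    rw [hQ]; ring
  rw [hcomb]
  subst hp
  have key := key_count (d := d) (Lc := Lc) ℓ k κ hQ0
  set M0 : ℝ := ((d : ℝ) + 1) * (((d : ℝ) + 1) *
      ((((2 * (4 * (d + 1) + 1) + 1) ^ (d + 1) : ℕ) : ℝ) * (2 * (ell (d + 1) Lc : ℝ) ^ 2))) with hM0
  set F : ℝ := |cΛ| / (Lc : ℝ) ^ (d + 1) * ((d : ℝ) + 1) *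
      (Real.exp (κ * (((d : ℝ) + 1) * (4 * ((d : ℝ) + 1) * (Lc + 1)) + (d + 1))) *
            Real.exp (κ * (((d : ℝ) + 1) * ((4 * ((d : ℝ) + 1) + 1) + 1) + (d + 1)))) *
      Zl (d + 1) (κ / 2) * Real.exp (-(κ / 2) * (l1 (x' - u') + l1 (z' - u'))) with hF
  have hF0 : 0 ≤ F := by rw [hF]; positivity
  calc |cΛ| / (Lc : ℝ) ^ (d + 1) * ((((Lc ^ (ℓ + k + 1) : ℕ) : ℝ)) ^ ((d : ℤ) - 2) * ((Lc : ℝ) ^ ℓ) ^ (d + 3)) *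
      (((d : ℝ) + 1) * ((((Lc ^ (ℓ + k + 1) : ℕ) : ℝ)) ^ (d + 2) * ((Lc : ℝ) ^ k * ((Q * (((Lc : ℝ) ^ (ℓ + k + 1)) ^ (2 * (d + 1)))⁻¹) * Real.exp κ)) *
          ((((2 * (2 * (2 * (d + 1) * (Lc + 1) * Lc ^ ℓ)) + 1) ^ (d + 1) : ℕ) : ℝ) * (((d : ℝ) + 1) * (((d : ℝ) + 1) *
            ((((2 * (4 * (d + 1) + 1) + 1) ^ (d + 1) : ℕ) : ℝ) * (2 * (ell (d + 1) Lc : ℝ) ^ 2 / ((Lc : ℝ) ^ ℓ) ^ (2 * (d + 1))))))) *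
          (Real.exp (κ * (((d : ℝ) + 1) * (4 * ((d : ℝ) + 1) * (Lc + 1)) + (d + 1))) *
            Real.exp (κ * (((d : ℝ) + 1) * ((4 * ((d : ℝ) + 1) + 1) + 1) + (d + 1))))) *
        Zl (d + 1) (κ / 2) * Real.exp (-(κ / 2) * (l1 (x' - u') + l1 (z' - u'))))
      = F * ((((Lc ^ (ℓ + k + 1) : ℕ) : ℝ)) ^ ((d : ℤ) - 2) * ((Lc : ℝ) ^ ℓ) ^ (d + 3) *
      (((((Lc ^ (ℓ + k + 1) : ℕ) : ℝ)) ^ (d + 2) * ((Lc : ℝ) ^ k * ((Q * (((Lc : ℝ) ^ (ℓ + k + 1)) ^ (2 * (d + 1)))⁻¹) * Real.exp κ))) *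
          ((((2 * (2 * (2 * (d + 1) * (Lc + 1) * Lc ^ ℓ)) + 1) ^ (d + 1) : ℕ) : ℝ) * (((d : ℝ) + 1) * (((d : ℝ) + 1) *
            ((((2 * (4 * (d + 1) + 1) + 1) ^ (d + 1) : ℕ) : ℝ) * (2 * (ell (d + 1) Lc : ℝ) ^ 2 / ((Lc : ℝ) ^ ℓ) ^ (2 * (d + 1))))))))) := by
        rw [hF]; ring
    _ ≤ F * ((Q * Real.exp κ) * ((((8 * (d + 1) * (Lc + 1) + 1 : ℕ) : ℝ) ^ (d + 1)) * M0) * ((Lc : ℝ) ^ (k + 2))⁻¹) :=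
        mul_le_mul_of_nonneg_left key hF0
    _ = _ := by rw [hF, hM0]; ring


end Main

/-! ## §4-ρ Member `p+1`'s rooted Λ piece ALIGNED onto member `p`'s lattice -/

section Aligned

variable {κ CA CB CΦ : ℝ}

/-- [folklore] **MEMBER `p+1`'s ROOTED Λ PIECE, ALIGNED** (in-block root `r`; level `ℓ+1` pushed `k` times, blocking `N₊ = Lc^{p+1}`): (ρ-c)'s ROOTED
`TaylorRowLamSymAt.piece_eq_pref_mul_sandwich` at `(ℓ+1, k, p+1)` followed by leaf-04-g20's «SANDWICH-DECIMATE*» (`sandwich_decimate_avgLift_of_legs`, the lift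
`avgLift (Lc^{ℓ+1}) = avgLift Lc ∘ avgLift (Lc^ℓ)` read against the `Lc`-DECIMATED outer legs `decLeg Lc`) and the prefactor alignment
`pref_succ_mul` pushed into the vertex leg (`TaylorDiffLam.sandwich_const_mul_vertex`): the piece is member `p`'s prefactor times a sandwich on member
`p`'s lattice with table `onLat (Lc^{ℓ+1}) (avgLift (Lc^ℓ) ∘ symHessFFAt (toSite r) Lc μ)`, outer legs `decLeg Lc G̃_{N₊}`, `decLeg Lc H̃_{N₊}` and vertex leg
`Lc^d · onLat (Lc^{ℓ+1}) (N₊^{d+2}·𝒬ᵀ_{Lc^k} Φ_{N₊}(·−u′) μ)`.  (The outer-leg and Φ bounds are used only for the absolute convergence inside the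
alignment identity.) -/
theorem piece_succ_eq_pref_mul_sandwich (hr : r ∈ box (d + 1) Lc) (cΛ : ℝ) (ℓ k p : ℕ) (hp : p = ℓ + k + 1) (hκ : 0 < κ) (hCΦ : 0 ≤ CΦ)
    (hA : ∀ (α l : Fin (d + 1)) (x' w : Site (d + 1)),
      |((Lc : ℝ) ^ (p + 1)) ^ (d + 2) * GamΦ (N := Lc ^ (p + 1)) α x' l w| ≤
        CA * Real.exp (-κ * l1 (x' - quo (Lc ^ (p + 1)) w)))
    (hB : ∀ (κ₁ l : Fin (d + 1)) (z : Site (d + 1)),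
      |((Lc : ℝ) ^ (p + 1)) ^ (d + 2) * wH (N := Lc ^ (p + 1)) κ₁ l z| ≤ CB * Real.exp (-κ * l1 (quo (Lc ^ (p + 1)) z)))
    (hΦ : ∀ (κ₁ l : Fin (d + 1)) (y : Site (d + 1)),
      |((Lc : ℝ) ^ (p + 1)) ^ (2 * (d + 1)) * wΦ (N := Lc ^ (p + 1)) κ₁ l y| ≤ CΦ * Real.exp (-κ * l1 y))
    (κ' : Fin (d + 1)) (u' x' z' : Site (d + 1)) (α β : Fin (d + 1)) :
    ((Lc : ℝ) ^ (p + 1)) ^ (2 * (d + 1)) *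
        e3OfS (Lc ^ (p + 1)) (fun κ u => (((Lc : ℝ) ^ (d + 1)) ^ k * (cΛ * ((Lc : ℝ) ^ (ℓ + 1)) ^ (2 * d + 4))) •
          symLagrIncAt d (toSite r) Lc (Lc ^ (ℓ + 1)) (Lc ^ (ℓ + 1 + 1)) κ u) κ' u' x' z' (Sum.inl α) (Sum.inl β) =
      (-(cΛ / (Lc : ℝ) ^ (d + 1)) * (((Lc ^ p : ℕ) : ℝ)) ^ ((d : ℤ) - 2) * ((Lc : ℝ) ^ ℓ) ^ (d + 3)) *
        ∑' y : Site (d + 1), ∑ l' : Fin (d + 1),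
          (∑' w : Site (d + 1), ∑ l : Fin (d + 1),
              decLeg Lc (fun l w => (((Lc ^ (p + 1) : ℕ) : ℝ)) ^ (d + 2) * GamΦ (N := Lc ^ (p + 1)) α x' l w) l w *
              ∑ μ : Fin (d + 1), ((((Lc ^ p : ℕ) : ℝ)) ^ (d + 1))⁻¹ * ∑' v : Site (d + 1),
                ((Lc : ℝ) ^ d * onLat (Lc ^ (ℓ + 1)) (fun Y => (((Lc ^ (p + 1) : ℕ) : ℝ)) ^ (d + 2) *
                    contourSumAdj (Lc ^ k) (fun κ₁ q => wΦ (N := Lc ^ (p + 1)) κ₁ κ' (q - u')) μ Y) v) *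
                  onLat (Lc ^ (ℓ + 1)) (fun Y => avgLift (Lc ^ ℓ) (symHessFFAt (toSite r) Lc μ Y)) v w y (Sum.inl l) (Sum.inl l')) *
            decLeg Lc (fun l' y => (((Lc ^ (p + 1) : ℕ) : ℝ)) ^ (d + 2) *
              wH (N := Lc ^ (p + 1)) l' β (y - ((Lc ^ (p + 1) : ℕ) : ℤ) • z')) l' y := by
  have hL0 : (0 : ℝ) < Lc := by exact_mod_cast Nat.pos_of_ne_zero (NeZero.ne Lc)
  have hL1 : (1 : ℝ) ≤ Lc := by exact_mod_cast (Nat.one_le_iff_ne_zero.2 (NeZero.ne Lc))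
  haveI hN0 : NeZero (Lc ^ p) := ⟨pow_ne_zero _ (NeZero.ne Lc)⟩
  haveI hNq0 : NeZero (Lc ^ (p + 1)) := ⟨pow_ne_zero _ (NeZero.ne Lc)⟩
  haveI hNp0 : NeZero (Lc ^ (ℓ + 1)) := ⟨pow_ne_zero _ (NeZero.ne Lc)⟩
  haveI hNp1 : NeZero (Lc ^ (ℓ + 1 + 1)) := ⟨pow_ne_zero _ (NeZero.ne Lc)⟩
  haveI hM0 : NeZero (Lc ^ ℓ) := ⟨pow_ne_zero _ (NeZero.ne Lc)⟩
  have hNp : Lc ^ (ℓ + 1) = Lc ^ ℓ * Lc := pow_succ Lc ℓ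
  have hcastq : (((Lc ^ (p + 1) : ℕ) : ℝ)) = (Lc : ℝ) ^ (p + 1) := by push_cast; rfl
  have hcast : (((Lc ^ p : ℕ) : ℝ)) = (Lc : ℝ) ^ p := by push_cast; rfl
  have hcastP : (((Lc ^ (ℓ + 1) : ℕ) : ℝ)) = (Lc : ℝ) ^ (ℓ + 1) := by push_cast; rfl
  have hcastM : (((Lc ^ ℓ : ℕ) : ℝ)) = (Lc : ℝ) ^ ℓ := by push_cast; rfl
  -- step 1: leaf-18's unit split + inner identity for member `p+1`
  rw [piece_eq_pref_mul_sandwich hr cΛ (ℓ + 1) k (p + 1) (by omega) κ' u' x' z' α β]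
  -- step 2: the alignment identity (leaf-04-g20), with its hypotheses
  set RWn : ℕ := 2 * (2 * (d + 1) * (Lc + 1) * Lc ^ ℓ) with hRWn
  set RW : ℝ := ((d : ℝ) + 1) * (4 * ((d : ℝ) + 1) * (Lc + 1)) * ((Lc ^ p : ℕ) : ℝ) with hRW
  set RU : ℝ := ((d : ℝ) + 1) * ((4 * ((d : ℝ) + 1) + 1) + 1) * ((Lc ^ p : ℕ) : ℝ) with hRU
  have hA' : ∀ (l : Fin (d + 1)) (w : Site (d + 1)),
      |((Lc ^ (p + 1) : ℕ) : ℝ) ^ (d + 2) * GamΦ (N := Lc ^ (p + 1)) α x' l w| ≤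
        CA * Real.exp (-κ * l1 (x' - quo (Lc ^ (p + 1)) w)) := fun l w => by
    rw [hcastq]; exact hA α l x' w
  have hB' : ∀ (l' : Fin (d + 1)) (y : Site (d + 1)),
      |((Lc ^ (p + 1) : ℕ) : ℝ) ^ (d + 2) * wH (N := Lc ^ (p + 1)) l' β (y - ((Lc ^ (p + 1) : ℕ) : ℤ) • z')| ≤
        CB * Real.exp (-κ * l1 (quo (Lc ^ (p + 1)) y - z')) := fun l' y => by
    have hq : quo (Lc ^ (p + 1)) (y - ((Lc ^ (p + 1) : ℕ) : ℤ) • z') = quo (Lc ^ (p + 1)) y - z' := by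
      rw [sub_eq_add_neg y, ← smul_neg, BlochFibreUniqueness.quo_add_zsmul, ← sub_eq_add_neg]
    rw [hcastq, ← hq]
    exact hB l' β _
  have hH' := fun μ v => abs_vertex_succ_raw_le (d := d) (Lc := Lc) ℓ k p hp hκ.le hCΦ hΦ κ' μ u' v
  have hSD := sandwich_decimate_avgLift_of_legs Lc (Lc ^ p) (Lc ^ (p + 1)) (Lc ^ (ℓ + 1)) (Lc ^ (ℓ + 1 + 1)) (Lc ^ ℓ) (Lc ^ (ℓ + 1))
    (pow_succ' Lc p) (pow_succ' Lc ℓ) (RW := RW) (RU := RU)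
    (A := fun l w => (((Lc ^ (p + 1) : ℕ) : ℝ)) ^ (d + 2) * GamΦ (N := Lc ^ (p + 1)) α x' l w)
    (B := fun l' y => (((Lc ^ (p + 1) : ℕ) : ℝ)) ^ (d + 2) * wH (N := Lc ^ (p + 1)) l' β (y - ((Lc ^ (p + 1) : ℕ) : ℤ) • z'))
    (ψ := fun μ Y => (((Lc ^ (p + 1) : ℕ) : ℝ)) ^ (d + 2) * contourSumAdj (Lc ^ k) (fun κ₁ q => wΦ (N := Lc ^ (p + 1)) κ₁ κ' (q - u')) μ Y)
    (K := fun μ Y => symHessFFAt (toSite r) Lc μ Y)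
    (Sw := fun y => Fintype.piFinset fun j => Finset.Icc (y j - RWn) (y j + RWn))
    (Su := fun y => (Fintype.piFinset fun j =>
        Finset.Icc (quo (Lc ^ (ℓ + 1)) y j - (4 * (d + 1) + 1 : ℕ)) (quo (Lc ^ (ℓ + 1)) y j + (4 * (d + 1) + 1 : ℕ))).image
      (fun Y : Site (d + 1) => ((Lc ^ (ℓ + 1) : ℕ) : ℤ) • Y))
    hκ hA' hB' hH'
    (fun μ v w l y l' hne => mem_boxW_of_ne_zero hr (Lc ^ (ℓ + 1)) (Lc ^ ℓ) hne)
    (fun μ v w l y l' hne => mem_imageY_of_ne_zero hr (Lc ^ (ℓ + 1)) (Lc ^ ℓ) hNp hne)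
    (fun y w hw => by
      have h := l1_le_of_mem_box hw
      have hle : ((d : ℝ) + 1) * RWn ≤ RW := by
        rw [hRW, hRWn, hcast]
        push_cast
        have hmono : ((Lc : ℝ) ^ ℓ) ≤ (Lc : ℝ) ^ p := pow_le_pow_right₀ hL1 (by omega)
        nlinarith [hmono, show (0 : ℝ) ≤ ((d : ℝ) + 1) * (4 * ((d : ℝ) + 1) * (Lc + 1)) by positivity]
      exact h.trans hle)
    (fun y v hv => by
      have h := l1_le_of_mem_imageY (d := d) (Lc ^ (ℓ + 1)) hv
      have hle : ((d : ℝ) + 1) * ((Lc ^ (ℓ + 1) : ℕ) : ℝ) * ((4 * (d + 1) + 1 : ℕ) + 1) ≤ RU := by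
        rw [hRU, hcastP, hcast]
        push_cast
        have hmono : ((Lc : ℝ) ^ (ℓ + 1)) ≤ (Lc : ℝ) ^ p := pow_le_pow_right₀ hL1 (by omega)
        nlinarith [hmono, show (0 : ℝ) ≤ ((d : ℝ) + 1) * ((4 * ((d : ℝ) + 1) + 1) + 1) by positivity]
      exact h.trans hle)
    (fun y l' => table_mass_le hr (Lc ^ (ℓ + 1)) (Lc ^ ℓ) y l' RWn)
  rw [hSD, ← mul_assoc, pref_succ_mul, mul_assoc, ← sandwich_const_mul_vertex]

end Aligned

end Summit.QuantumFields.BalabanUV.Beta.GAN24.S3DiffLSymAt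

end
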